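import Literature.Computability.AlgebraicComplexity.MS21ANFHasseBlockLemmas
import Literature.Computability.AlgebraicComplexity.MS21FormulasToANF
import Literature.Computability.AlgebraicComplexity.MS21ANFFirstDerivativeHitting
import HarnessLib

/-!
# Second-order (Hasse) derivatives of `ANF_{Δ+1} = A₀A₁ + A₂A₃`: extraction of the blockwise
# consequences (B36 structure lemma, stage S3; cell `val-lit`, seat t18 g5)

Theorem-only file. Blueprint v2 `HOME/np/t18g5-MS21-thm35-B36-hasse-blueprint.md` — the
"SEPARATION of the six terms" step of the ANF structure lemma (characteristic-free repair of
[MediniShpilka2021, Lemma 5.13 (arXiv:2102.05632 p0029:L3-L26)], registry item B36).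

Write `ANF_{Δ+1} = A_b A_{b̄} + A_{b+2} A_{b̄+2}` (`b̄ = 1 - b`, Def 8; `A_b = ANF_Δ(x^{(b)})`) and let
`c, c'` be directions. By the Leibniz rules, `Δ²_c ANF_{Δ+1}` (resp. `∂_c ∂_{c'} ANF_{Δ+1}`) is a sum
of six (eight) products of blockwise derivatives; killing the two blocks of the other pair
(`aeval` with `0` on them — every factor there has zero constant term once `Δ ≥ 1`) and then taking
weighted homogeneous components for the weight "degree in the block `b̄`" (values `2^Δ`, `2^Δ - 1`,
`2^Δ - 2`, pairwise distinct once `Δ ≥ 1`) separates them. Consequences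
(`MS2021.anf_succ_hasseD_two_extract`, `MS2021.anf_succ_pderiv_pderiv_extract`): if
`Δ²_c ANF_{Δ+1} = 0` then `Δ²_{c|b} ANF_Δ = 0` and `∂_{c|b} ANF_Δ · ∂_{c|b̄} ANF_Δ = 0` (so one of the two
restricted directions annihilates — Cor 5.10 — i.e. VANISHES on that block); if
`∂_c∂_{c'} ANF_{Δ+1} = 0` then `∂_{c|b}∂_{c'|b} ANF_Δ = 0` and the cross term
`∂_{c|b}ANF_Δ(x^{(b)})·∂_{c'|b̄}ANF_Δ(x^{(b̄)}) + ∂_{c'|b}ANF_Δ(x^{(b)})·∂_{c|b̄}ANF_Δ(x^{(b̄)}) = 0`.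

No definitions, no facts (D-0026). HONEST FRAMING: toolkit towards a characteristic-free proof of a
2021 published lemma; `VP ≠ VNP` is NOT proved and nothing here bears on it.

## References
* [MediniShpilka2021] D. Medini, A. Shpilka, CCC 2021 (LIPIcs 200:19) = arXiv:2102.05632: Def 8
  (ANF), Obs 5.8 / Cor 5.10 (p0025:L57-L70), Lemma 5.13 (p0029:L3-L26).
-/

noncomputable section

open MvPolynomial

namespace Literature.Computability.AlgebraicComplexity

namespace MS2021

/-! ### Generic: renaming and indicator weights, projections killing blocks -/

section Generic

variable {K : Type*} [CommRing K] {σ τ : Type*}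

/-- `aeval (X ∘ e) = rename e`. [folklore] -/
private theorem aeval_X_comp_eq_rename' (e : σ → τ) (p : MvPolynomial σ K) :
    aeval (fun s => (X (e s) : MvPolynomial τ K)) p = rename e p := by
  induction p using MvPolynomial.induction_on with
  | C a => rw [algHom_C, algHom_C]
  | add p q hp hq => rw [map_add, map_add, hp, hq]
  | mul_X p s hp => rw [map_mul, map_mul, hp, aeval_X, rename_X]

/-- A renamed polynomial all of whose new variables have weight `0` is weighted-homogeneous of
weight `0`. [cite: MediniShpilka2021, Def 8 (block variables; arXiv p0025)] -/
theorem isWeightedHomogeneous_rename_zero (e : σ → τ) (he : Function.Injective e) (w : τ → ℕ)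
    (hw : ∀ j, w (e j) = 0) (ψ : MvPolynomial σ K) :
    IsWeightedHomogeneous w (rename e ψ) 0 := by
  classical
  intro d hd
  obtain ⟨u, rfl, -⟩ := coeff_rename_ne_zero e ψ d hd
  rw [Finsupp.weight_apply, Finsupp.sum_mapDomain_index_inj he]
  simp_rw [hw, smul_zero]
  rw [Finsupp.sum]
  exact Finset.sum_const_zero

/-- A renamed HOMOGENEOUS polynomial all of whose new variables have weight `1` is
weighted-homogeneous of its degree. [cite: MediniShpilka2021, Def 8 (block variables; arXiv p0025)] -/
theorem isWeightedHomogeneous_rename_one (e : σ → τ) (he : Function.Injective e) (w : τ → ℕ)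
    (hw : ∀ j, w (e j) = 1) {ψ : MvPolynomial σ K} {n : ℕ} (hψ : ψ.IsHomogeneous n) :
    IsWeightedHomogeneous w (rename e ψ) n := by
  classical
  intro d hd
  obtain ⟨u, rfl, hu⟩ := coeff_rename_ne_zero e ψ d hd
  have hdeg : Finsupp.weight (1 : σ → ℕ) u = n := hψ hu
  rw [Finsupp.weight_apply, Finsupp.sum_mapDomain_index_inj he]
  rw [Finsupp.weight_apply] at hdeg
  simp_rw [hw]
  simpa using hdeg

end Generic

/-! ### The blocks of `ANF_{Δ+1}` -/

section Blocks

variable (K : Type*) [Field K]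

/-- The four block indices `b, 1-b, b+2, 1-(b+2)` are what they should be. [cite: MediniShpilka2021, Def 8 (arXiv p0025)] -/
theorem pair_indices (b : Fin 4) :
    (1 - b ≠ b) ∧ ¬ (b + 2 = b ∨ b + 2 = 1 - b) ∧ ¬ (1 - (b + 2) = b ∨ 1 - (b + 2) = 1 - b) := by
  fin_cases b <;> decide

variable {K}

/-- `ANF_Δ` has zero constant term. [cite: MediniShpilka2021, Obs 5.2/Def 8 (arXiv p0025)] -/
theorem constantCoeff_anf (Δ : ℕ) : constantCoeff (anf K Δ) = 0 := by
  rw [constantCoeff_eq]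
  exact (isHomogeneous_anf K Δ).coeff_eq_zero (d := 0) (by
    rw [map_zero]; exact (Nat.pos_of_ne_zero (pow_ne_zero Δ two_ne_zero)).ne)

/-- First Hasse derivatives of `ANF_Δ`, `Δ ≥ 1`, have zero constant term (they are homogeneous of
degree `2^Δ - 1 ≥ 1`, Cor 5.10). [cite: MediniShpilka2021, Cor 5.10 (arXiv p0025:L65-L70)] -/
theorem constantCoeff_hasseD_one_anf {Δ : ℕ} (hΔ : 1 ≤ Δ) (u : Fin (4 ^ Δ) → K) :
    constantCoeff (hasseD 1 u (anf K Δ)) = 0 := by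
  classical
  rw [hasseD_one, constantCoeff_eq]
  refine (isHomogeneous_sum_C_mul_pderiv_anf K Δ u).coeff_eq_zero (d := 0) ?_
  rw [map_zero]
  have : 2 ≤ 2 ^ Δ := by
    calc (2 : ℕ) = 2 ^ 1 := by norm_num
      _ ≤ 2 ^ Δ := Nat.pow_le_pow_right (by norm_num) hΔ
  omega

/-- `Δ²_v ANF_Δ` is homogeneous of degree `2^Δ - 2` (polarisation into mixed second derivatives of
the multilinear `ANF_Δ`). [cite: MediniShpilka2021, Lemma 5.13/5.14 (arXiv p0029:L3-L34)] -/
theorem isHomogeneous_hasseD_two_anf (Δ : ℕ) (v : Fin (4 ^ Δ) → K) :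
    (hasseD 2 v (anf K Δ)).IsHomogeneous (2 ^ Δ - 2) := by
  classical
  rw [hasseD_two_eq_sum_lt_of_multilinear (anf K Δ) (degreeOf_anf_le_one K Δ) v]
  refine IsHomogeneous.sum _ _ _ fun a _ => IsHomogeneous.sum _ _ _ fun b _ => ?_
  have h := ((isHomogeneous_anf K Δ).pderiv (i := b)).pderiv (i := a)
  have e : 2 ^ Δ - 1 - 1 = 2 ^ Δ - 2 := by omega
  rw [e] at h
  exact h.C_mul _

/-- `Δ¹_v ANF_Δ` is homogeneous of degree `2^Δ - 1`. [cite: MediniShpilka2021, Cor 5.10 (arXiv p0025:L65-L70)] -/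
theorem isHomogeneous_hasseD_one_anf (Δ : ℕ) (v : Fin (4 ^ Δ) → K) :
    (hasseD 1 v (anf K Δ)).IsHomogeneous (2 ^ Δ - 1) := by
  classical
  rw [hasseD_one]
  exact isHomogeneous_sum_C_mul_pderiv_anf K Δ v

/-- **Cor 5.10 in Hasse form**: `Δ¹_u ANF_Δ = 0 ↔ u = 0`. [cite: MediniShpilka2021, Cor 5.10 (arXiv p0025:L65-L70)] -/
theorem hasseD_one_anf_eq_zero_iff (Δ : ℕ) (u : Fin (4 ^ Δ) → K) :
    hasseD 1 u (anf K Δ) = 0 ↔ u = 0 := by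
  classical
  rw [hasseD_one]
  constructor
  · intro h
    by_contra hu
    exact sum_C_mul_pderiv_anf_ne_zero K Δ u hu h
  · rintro rfl
    exact Finset.sum_eq_zero fun i _ => by rw [Pi.zero_apply, C_0, zero_mul]

end Blocks

/-! ### Extraction -/

section Extract

variable {K : Type*} [Field K] {Δ : ℕ}

/-- The projection keeping the blocks `b`, `1-b` and killing the other two fixes block-`b`/`1-b`
renames. [cite: MediniShpilka2021, Def 8 (arXiv p0025)] -/
theorem proj_rename_keep (b : Fin 4) {b' : Fin 4} (hb' : b' = b ∨ b' = 1 - b)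
    (ψ : MvPolynomial (Fin (4 ^ Δ)) K) :
    aeval (anfBlocks Δ fun b'' j =>
        if b'' = b ∨ b'' = 1 - b then (X (anfBlock Δ b'' j) : MvPolynomial (Fin (4 ^ (Δ + 1))) K)
        else 0) (rename (anfBlock Δ b') ψ) = rename (anfBlock Δ b') ψ := by
  rw [aeval_rename]
  have hfun : ((anfBlocks Δ fun b'' j =>
      if b'' = b ∨ b'' = 1 - b then (X (anfBlock Δ b'' j) : MvPolynomial (Fin (4 ^ (Δ + 1))) K)
      else 0) ∘ anfBlock Δ b') = fun j => X (anfBlock Δ b' j) := by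
    funext j
    rw [Function.comp_apply, anfBlocks_anfBlock, if_pos hb']
  rw [hfun, aeval_X_comp_eq_rename']

/-- … and kills the renames of the other two blocks of polynomials with zero constant term.
[cite: MediniShpilka2021, Def 8 (arXiv p0025)] -/
theorem proj_rename_kill (b : Fin 4) {b' : Fin 4} (hb' : ¬ (b' = b ∨ b' = 1 - b))
    {ψ : MvPolynomial (Fin (4 ^ Δ)) K} (hψ : constantCoeff ψ = 0) :
    aeval (anfBlocks Δ fun b'' j =>
        if b'' = b ∨ b'' = 1 - b then (X (anfBlock Δ b'' j) : MvPolynomial (Fin (4 ^ (Δ + 1))) K)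
        else 0) (rename (anfBlock Δ b') ψ) = 0 := by
  rw [aeval_rename]
  have hfun : ((anfBlocks Δ fun b'' j =>
      if b'' = b ∨ b'' = 1 - b then (X (anfBlock Δ b'' j) : MvPolynomial (Fin (4 ^ (Δ + 1))) K)
      else 0) ∘ anfBlock Δ b') = (0 : Fin (4 ^ Δ) → MvPolynomial (Fin (4 ^ (Δ + 1))) K) := by
    funext j
    rw [Function.comp_apply, anfBlocks_anfBlock, if_neg hb', Pi.zero_apply]
  rw [hfun, aeval_zero, hψ, map_zero]

/-- The weight "degree in the block `b₁`". [cite: MediniShpilka2021, Def 8 (arXiv p0025)] -/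
theorem blockWeight_apply (b₁ b' : Fin 4) (j : Fin (4 ^ Δ)) :
    anfBlocks Δ (fun b'' (_ : Fin (4 ^ Δ)) => if b'' = b₁ then (1 : ℕ) else 0) (anfBlock Δ b' j) =
      if b' = b₁ then 1 else 0 := by
  rw [anfBlocks_anfBlock]

/-- **Extraction, Hasse case.** If `Δ ≥ 1` and `Δ²_c ANF_{Δ+1} = 0` then, for every block `b`:
`Δ²_{c|b} ANF_Δ = 0` and `Δ¹_{c|b} ANF_Δ(x^{(b)}) · Δ¹_{c|1-b} ANF_Δ(x^{(1-b)}) = 0`.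
[cite: MediniShpilka2021, Lemma 5.13 (arXiv p0029:L3-L26) — replacement of its second bullet] -/
theorem anf_succ_hasseD_two_extract (hΔ : 1 ≤ Δ) (c : Fin (4 ^ (Δ + 1)) → K)
    (hc : hasseD 2 c (anf K (Δ + 1)) = 0) (b : Fin 4) :
    hasseD 2 (c ∘ anfBlock Δ b) (anf K Δ) = 0 ∧
      rename (anfBlock Δ b) (hasseD 1 (c ∘ anfBlock Δ b) (anf K Δ)) *
        rename (anfBlock Δ (1 - b)) (hasseD 1 (c ∘ anfBlock Δ (1 - b)) (anf K Δ)) = 0 := by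
  classical
  obtain ⟨hbb, hb2, hb3⟩ := pair_indices b
  have hD : 2 ≤ 2 ^ Δ := by
    calc (2 : ℕ) = 2 ^ 1 := by norm_num
      _ ≤ 2 ^ Δ := Nat.pow_le_pow_right (by norm_num) hΔ
  -- names
  set e : Fin 4 → Fin (4 ^ Δ) → Fin (4 ^ (Δ + 1)) := anfBlock Δ with he
  set A : Fin 4 → MvPolynomial (Fin (4 ^ (Δ + 1))) K := fun b' => rename (e b') (anf K Δ) with hA
  set H1 : Fin 4 → MvPolynomial (Fin (4 ^ (Δ + 1))) K :=
    fun b' => rename (e b') (hasseD 1 (c ∘ e b') (anf K Δ)) with hH1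
  set H2 : Fin 4 → MvPolynomial (Fin (4 ^ (Δ + 1))) K :=
    fun b' => rename (e b') (hasseD 2 (c ∘ e b') (anf K Δ)) with hH2
  have hd1 : ∀ b', hasseD 1 c (A b') = H1 b' := fun b' => hasseD_rename _ _ _ _
  have hd2 : ∀ b', hasseD 2 c (A b') = H2 b' := fun b' => hasseD_rename _ _ _ _
  -- the six-term expansion
  have hexp : hasseD 2 c (anf K (Δ + 1)) =
      (H2 b * A (1 - b) + H1 b * H1 (1 - b) + A b * H2 (1 - b)) +
        (H2 (b + 2) * A (1 - (b + 2)) + H1 (b + 2) * H1 (1 - (b + 2)) +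
          A (b + 2) * H2 (1 - (b + 2))) := by
    rw [anf_succ_eq_block K Δ b, hasseD_add, hasseD_two_mul, hasseD_two_mul, hd1, hd1, hd1, hd1, hd2,
      hd2, hd2, hd2]
  -- kill the other pair
  set π : MvPolynomial (Fin (4 ^ (Δ + 1))) K →ₐ[K] MvPolynomial (Fin (4 ^ (Δ + 1))) K :=
    aeval (anfBlocks Δ fun b'' j =>
      if b'' = b ∨ b'' = 1 - b then (X (anfBlock Δ b'' j) : MvPolynomial (Fin (4 ^ (Δ + 1))) K)
      else 0) with hπ
  have hπA : ∀ b', (b' = b ∨ b' = 1 - b) → π (A b') = A b' := fun b' h => proj_rename_keep b h _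
  have hπH1 : ∀ b', (b' = b ∨ b' = 1 - b) → π (H1 b') = H1 b' := fun b' h => proj_rename_keep b h _
  have hπH2 : ∀ b', (b' = b ∨ b' = 1 - b) → π (H2 b') = H2 b' := fun b' h => proj_rename_keep b h _
  have hπA0 : ∀ b', ¬ (b' = b ∨ b' = 1 - b) → π (A b') = 0 :=
    fun b' h => proj_rename_kill b h (constantCoeff_anf Δ)
  have hπH10 : ∀ b', ¬ (b' = b ∨ b' = 1 - b) → π (H1 b') = 0 :=
    fun b' h => proj_rename_kill b h (constantCoeff_hasseD_one_anf hΔ _)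
  have h3 : H2 b * A (1 - b) + H1 b * H1 (1 - b) + A b * H2 (1 - b) = 0 := by
    have := congrArg π hexp
    rw [hc, map_zero, map_add, map_add, map_add, map_add, map_add, map_mul, map_mul, map_mul,
      map_mul, map_mul, map_mul, hπH2 b (Or.inl rfl), hπA (1 - b) (Or.inr rfl),
      hπH1 b (Or.inl rfl), hπH1 (1 - b) (Or.inr rfl), hπA b (Or.inl rfl), hπH2 (1 - b) (Or.inr rfl),
      hπA0 (1 - (b + 2)) hb3, hπH10 (b + 2) hb2, hπA0 (b + 2) hb2] at this
    simpa using this.symm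
  -- weights: degree in the block `1 - b`
  set w : Fin (4 ^ (Δ + 1)) → ℕ := anfBlocks Δ (fun b'' _ => if b'' = 1 - b then 1 else 0) with hw
  have hw1 : ∀ j, w (e (1 - b) j) = 1 := fun j => by rw [hw, he, blockWeight_apply, if_pos rfl]
  have hw0 : ∀ j, w (e b j) = 0 := fun j => by rw [hw, he, blockWeight_apply, if_neg (Ne.symm hbb)]
  have inj : ∀ b', Function.Injective (e b') := fun b' => anfBlock_injective Δ b'
  have hT1 : IsWeightedHomogeneous w (H2 b * A (1 - b)) (0 + 2 ^ Δ) :=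
    (isWeightedHomogeneous_rename_zero _ (inj b) w hw0 _).mul
      (isWeightedHomogeneous_rename_one _ (inj (1 - b)) w hw1 (isHomogeneous_anf K Δ))
  have hT2 : IsWeightedHomogeneous w (H1 b * H1 (1 - b)) (0 + (2 ^ Δ - 1)) :=
    (isWeightedHomogeneous_rename_zero _ (inj b) w hw0 _).mul
      (isWeightedHomogeneous_rename_one _ (inj (1 - b)) w hw1 (isHomogeneous_hasseD_one_anf Δ _))
  have hT3 : IsWeightedHomogeneous w (A b * H2 (1 - b)) (0 + (2 ^ Δ - 2)) :=
    (isWeightedHomogeneous_rename_zero _ (inj b) w hw0 _).mul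
      (isWeightedHomogeneous_rename_one _ (inj (1 - b)) w hw1 (isHomogeneous_hasseD_two_anf Δ _))
  rw [zero_add] at hT1 hT2 hT3
  -- component of weight `2^Δ`: `T₁ = 0`; of weight `2^Δ - 1`: `T₂ = 0`
  have hc1 := congrArg (weightedHomogeneousComponent w (2 ^ Δ)) h3
  rw [map_add, map_add, map_zero, hT1.weightedHomogeneousComponent_same,
    hT2.weightedHomogeneousComponent_ne (2 ^ Δ) (by omega),
    hT3.weightedHomogeneousComponent_ne (2 ^ Δ) (by omega), add_zero, add_zero] at hc1
  have hc2 := congrArg (weightedHomogeneousComponent w (2 ^ Δ - 1)) h3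
  rw [map_add, map_add, map_zero, hT1.weightedHomogeneousComponent_ne (2 ^ Δ - 1) (by omega),
    hT2.weightedHomogeneousComponent_same,
    hT3.weightedHomogeneousComponent_ne (2 ^ Δ - 1) (by omega), zero_add, add_zero] at hc2
  refine ⟨?_, hc2⟩
  -- `T₁ = H2 b · A(1-b) = 0` with `A(1-b) ≠ 0` gives `H2 b = 0`, hence its preimage vanishes
  have hA0 : A (1 - b) ≠ 0 := by
    rw [hA]
    exact fun h0 => anf_ne_zero K Δ ((map_eq_zero_iff _ (rename_injective _ (inj (1 - b)))).1 h0)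
  have hH2 : H2 b = 0 := (mul_eq_zero.1 hc1).resolve_right hA0
  exact (map_eq_zero_iff _ (rename_injective _ (inj b))).1 hH2

/-- **Extraction, mixed case.** If `Δ ≥ 1` and `∂_c∂_{c'} ANF_{Δ+1} = 0` then, for every block `b`:
`∂_{c|b}∂_{c'|b} ANF_Δ = 0` and the cross term
`∂_{c|b}ANF_Δ(x^{(b)})·∂_{c'|1-b}ANF_Δ(x^{(1-b)}) + ∂_{c'|b}ANF_Δ(x^{(b)})·∂_{c|1-b}ANF_Δ(x^{(1-b)})`
vanishes. [cite: MediniShpilka2021, Lemma 5.13 (arXiv p0029:L3-L26) — replacement of its second bullet] -/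
theorem anf_succ_pderiv_pderiv_extract (hΔ : 1 ≤ Δ) (c c' : Fin (4 ^ (Δ + 1)) → K)
    (hc : hasseD 1 c (hasseD 1 c' (anf K (Δ + 1))) = 0) (b : Fin 4) :
    hasseD 1 (c ∘ anfBlock Δ b) (hasseD 1 (c' ∘ anfBlock Δ b) (anf K Δ)) = 0 ∧
      rename (anfBlock Δ b) (hasseD 1 (c ∘ anfBlock Δ b) (anf K Δ)) *
          rename (anfBlock Δ (1 - b)) (hasseD 1 (c' ∘ anfBlock Δ (1 - b)) (anf K Δ)) +
        rename (anfBlock Δ b) (hasseD 1 (c' ∘ anfBlock Δ b) (anf K Δ)) *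
          rename (anfBlock Δ (1 - b)) (hasseD 1 (c ∘ anfBlock Δ (1 - b)) (anf K Δ)) = 0 := by
  classical
  obtain ⟨hbb, hb2, hb3⟩ := pair_indices b
  have hD : 2 ≤ 2 ^ Δ := by
    calc (2 : ℕ) = 2 ^ 1 := by norm_num
      _ ≤ 2 ^ Δ := Nat.pow_le_pow_right (by norm_num) hΔ
  set e : Fin 4 → Fin (4 ^ Δ) → Fin (4 ^ (Δ + 1)) := anfBlock Δ with he
  set A : Fin 4 → MvPolynomial (Fin (4 ^ (Δ + 1))) K := fun b' => rename (e b') (anf K Δ) with hA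
  set G : Fin 4 → MvPolynomial (Fin (4 ^ (Δ + 1))) K :=
    fun b' => rename (e b') (hasseD 1 (c ∘ e b') (anf K Δ)) with hG
  set G' : Fin 4 → MvPolynomial (Fin (4 ^ (Δ + 1))) K :=
    fun b' => rename (e b') (hasseD 1 (c' ∘ e b') (anf K Δ)) with hG'
  set GG : Fin 4 → MvPolynomial (Fin (4 ^ (Δ + 1))) K :=
    fun b' => rename (e b') (hasseD 1 (c ∘ e b') (hasseD 1 (c' ∘ e b') (anf K Δ))) with hGG
  have hd : ∀ b', hasseD 1 c (A b') = G b' := fun b' => hasseD_rename _ _ _ _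
  have hd' : ∀ b', hasseD 1 c' (A b') = G' b' := fun b' => hasseD_rename _ _ _ _
  have hdd : ∀ b', hasseD 1 c (G' b') = GG b' := fun b' => hasseD_rename _ _ _ _
  -- the eight-term expansion
  have hexp : hasseD 1 c (hasseD 1 c' (anf K (Δ + 1))) =
      (GG b * A (1 - b) + G' b * G (1 - b) + (G b * G' (1 - b) + A b * GG (1 - b))) +
        (GG (b + 2) * A (1 - (b + 2)) + G' (b + 2) * G (1 - (b + 2)) +
          (G (b + 2) * G' (1 - (b + 2)) + A (b + 2) * GG (1 - (b + 2)))) := by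
    rw [anf_succ_eq_block K Δ b, hasseD_add, hasseD_one_mul, hasseD_one_mul, hd', hd', hd', hd',
      hasseD_add, hasseD_add, hasseD_add, hasseD_one_mul, hasseD_one_mul, hasseD_one_mul,
      hasseD_one_mul, hdd, hdd, hd, hd, hd, hd, hdd, hdd]
  set π : MvPolynomial (Fin (4 ^ (Δ + 1))) K →ₐ[K] MvPolynomial (Fin (4 ^ (Δ + 1))) K :=
    aeval (anfBlocks Δ fun b'' j =>
      if b'' = b ∨ b'' = 1 - b then (X (anfBlock Δ b'' j) : MvPolynomial (Fin (4 ^ (Δ + 1))) K)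
      else 0) with hπ
  have hπA : ∀ b', (b' = b ∨ b' = 1 - b) → π (A b') = A b' := fun b' h => proj_rename_keep b h _
  have hπG : ∀ b', (b' = b ∨ b' = 1 - b) → π (G b') = G b' := fun b' h => proj_rename_keep b h _
  have hπG' : ∀ b', (b' = b ∨ b' = 1 - b) → π (G' b') = G' b' := fun b' h => proj_rename_keep b h _
  have hπGG : ∀ b', (b' = b ∨ b' = 1 - b) → π (GG b') = GG b' := fun b' h => proj_rename_keep b h _
  have hπA0 : ∀ b', ¬ (b' = b ∨ b' = 1 - b) → π (A b') = 0 :=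
    fun b' h => proj_rename_kill b h (constantCoeff_anf Δ)
  have hπG0 : ∀ b', ¬ (b' = b ∨ b' = 1 - b) → π (G b') = 0 :=
    fun b' h => proj_rename_kill b h (constantCoeff_hasseD_one_anf hΔ _)
  have hπG'0 : ∀ b', ¬ (b' = b ∨ b' = 1 - b) → π (G' b') = 0 :=
    fun b' h => proj_rename_kill b h (constantCoeff_hasseD_one_anf hΔ _)
  have h4 : GG b * A (1 - b) + G' b * G (1 - b) + (G b * G' (1 - b) + A b * GG (1 - b)) = 0 := by
    have := congrArg π hexp
    rw [hc, map_zero] at this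
    simp only [map_add, map_mul] at this
    rw [hπGG b (Or.inl rfl),
      hπA (1 - b) (Or.inr rfl), hπG' b (Or.inl rfl), hπG (1 - b) (Or.inr rfl), hπG b (Or.inl rfl),
      hπG' (1 - b) (Or.inr rfl), hπA b (Or.inl rfl), hπGG (1 - b) (Or.inr rfl),
      hπA0 (1 - (b + 2)) hb3, hπG'0 (b + 2) hb2, hπG0 (b + 2) hb2, hπA0 (b + 2) hb2] at this
    simpa using this.symm
  -- weights
  set w : Fin (4 ^ (Δ + 1)) → ℕ := anfBlocks Δ (fun b'' _ => if b'' = 1 - b then 1 else 0) with hw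
  have hw1 : ∀ j, w (e (1 - b) j) = 1 := fun j => by rw [hw, he, blockWeight_apply, if_pos rfl]
  have hw0 : ∀ j, w (e b j) = 0 := fun j => by rw [hw, he, blockWeight_apply, if_neg (Ne.symm hbb)]
  have inj : ∀ b', Function.Injective (e b') := fun b' => anfBlock_injective Δ b'
  have hT1 : IsWeightedHomogeneous w (GG b * A (1 - b)) (0 + 2 ^ Δ) :=
    (isWeightedHomogeneous_rename_zero _ (inj b) w hw0 _).mul
      (isWeightedHomogeneous_rename_one _ (inj (1 - b)) w hw1 (isHomogeneous_anf K Δ))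
  have hT2 : IsWeightedHomogeneous w (G' b * G (1 - b) + G b * G' (1 - b)) (0 + (2 ^ Δ - 1)) :=
    ((isWeightedHomogeneous_rename_zero _ (inj b) w hw0 _).mul
      (isWeightedHomogeneous_rename_one _ (inj (1 - b)) w hw1 (isHomogeneous_hasseD_one_anf Δ _))).add
    ((isWeightedHomogeneous_rename_zero _ (inj b) w hw0 _).mul
      (isWeightedHomogeneous_rename_one _ (inj (1 - b)) w hw1 (isHomogeneous_hasseD_one_anf Δ _)))
  have hT3 : IsWeightedHomogeneous w (A b * GG (1 - b)) (0 + (2 ^ Δ - 1 - 1)) := by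
    refine (isWeightedHomogeneous_rename_zero _ (inj b) w hw0 _).mul
      (isWeightedHomogeneous_rename_one _ (inj (1 - b)) w hw1 ?_)
    have h1 := isHomogeneous_hasseD_one_anf (K := K) Δ (c' ∘ e (1 - b))
    rw [hasseD_one]
    refine IsHomogeneous.sum _ _ _ fun i _ => (h1.pderiv (i := i)).C_mul _
  rw [zero_add] at hT1 hT2 hT3
  have h4' : GG b * A (1 - b) + (G' b * G (1 - b) + G b * G' (1 - b)) + A b * GG (1 - b) = 0 := by
    rw [← h4]; ring
  have hc1 := congrArg (weightedHomogeneousComponent w (2 ^ Δ)) h4'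
  rw [map_add, map_add, map_zero, hT1.weightedHomogeneousComponent_same,
    hT2.weightedHomogeneousComponent_ne (2 ^ Δ) (by omega),
    hT3.weightedHomogeneousComponent_ne (2 ^ Δ) (by omega), add_zero, add_zero] at hc1
  have hc2 := congrArg (weightedHomogeneousComponent w (2 ^ Δ - 1)) h4'
  rw [map_add, map_add, map_zero, hT1.weightedHomogeneousComponent_ne (2 ^ Δ - 1) (by omega),
    hT2.weightedHomogeneousComponent_same,
    hT3.weightedHomogeneousComponent_ne (2 ^ Δ - 1) (by omega), zero_add, add_zero] at hc2
  refine ⟨?_, (add_comm _ _).trans hc2⟩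
  have hA0 : A (1 - b) ≠ 0 := by
    rw [hA]
    exact fun h0 => anf_ne_zero K Δ ((map_eq_zero_iff _ (rename_injective _ (inj (1 - b)))).1 h0)
  have hGG : GG b = 0 := (mul_eq_zero.1 hc1).resolve_right hA0
  exact (map_eq_zero_iff _ (rename_injective _ (inj b))).1 hGG

end Extract

end MS2021

end Literature.Computability.AlgebraicComplexity
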